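import Summits.BirchSwinnertonDyer.Rank1Residual.F1Sign2.MazurTateFittingShadowAtTwo

/-!
# Cell `bsd-f1-sign2` — IMC lens (seat `-imc`, PLANNER-OF-RECORD) g6, MEMO-imc §10.60, pre-registration P24: **IMC-MTF2♭ «LAMBDA-FLOOR»**
# `MazurTateLambdaFloorAtTwo` — the μ-STRIPPED `𝔽₂`-shadow of Kurihara's finite-layer pair `(θ_n, ν θ_{n-1})` at `p = 2` bounds
# `min(s_n, 2^n)` from BELOW, with no Tamagawa, CM or rank hypothesis

SIBLING MODULE of the landed `F1Sign2/MazurTateFittingShadowAtTwo.lean` (p611562 IMC-MTF2 + p613149 IMC-MTF2♯ + p616216 IMC-MTF2♮; that file is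
at 395/400 lines, the cap for modules carrying proofs, hence a new module rather than a third append): imports it, restates nothing.
STATEMENTS ONLY: two helper defs WITH BODIES (`twoAdicLambdaOrd` = λ₂, `mtPairLambdaShadow` = m'_n), ONE `@[conjecture] def` (conjecture-grade
candidate, nothing asserted) and five PROVED lemmas (`mtPairLambdaShadow_le`, `twoAdicLambdaOrd_eq_twoAdicUnitOrd`, `mtPairLambdaShadow_eq_mtPairShadow`,
`shadow_exact_of_lambdaFloor_of_sandwich`, `shadow_exact_of_lambdaFloor_of_sandwich_of_unit`); no `instance`, no `notation`, no named Literature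
fact, no `sorry`.

TYPER FILING (seat `bsd-f1-sign2-ty` g8; CANDIDATES.md row IMC-MTF2♭; -imc g6 CANDIDATES-delta 2026-08-28T08:07:38Z «REGISTER only; file after REF1
clears, as a further APPEND» + 08:13:20Z v2.5.1): bodies VERBATIM from `HOME/MEMO-imc-data/dimc17/SketchG6MTF2F-v25.lean` v2.5.1 ee7fef44d09f600d (126 l.;
farm rc 0 · 0 sorry · 0 warn; conjecture text = v2.5 134f2e5909ab9313) — builder `tools/mk_mtf2f.py` (published with the filed text under
`HOME/MEMO-ty-data/g8/`) applies: this header (the planner's module summary kept verbatim below), one docstring on `mtPairLambdaShadow_le`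
(`lint.docstring`), the REF1 and REF2 verdict sentences; module name chosen by the typer (sibling instead of append — line cap; -imc notified 08:20:17Z).
REF1-AUDIT-v1 §84 (2026-08-28T08:26:10Z, D-imc-ref1-19; evidence `HOME/REF1-data/b84/`: Probe84.lean 39460b7946f7b6c9 = this body VERBATIM on the
landed shadow module + audit lemmas e1–e9, farm rc 0 · 0 err · 0 warn · 0 sorry, axioms {propext, Classical.choice, Quot.sound}; `lamfloor_check.py`
independent of -imc's `lamfloor.py`; `binder_cmp.txt`: binder block = the landed SANDWICH block VERBATIM 6/6): **IMC-MTF2♭ `MazurTateLambdaFloorAtTwo`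
SURVIVES conjecture-grade (pre-registered P24), CLEARED for filing as typed; the two defs are FAITHFUL to their docstrings and to the engine's `lam`
column; the three structural claims are KERNEL facts (now the support section below): `λ₂(0) = ⊤` (e1; the engine's `mu = 99` sentinel), NORMALISATION-
FREENESS `λ₂(c·P) = λ₂(P)` for `c ≠ 0` (e2), FLOOR ≤ CAP `λ₂(P) ≤ twoAdicUnitOrd P` for 2-integral `P` (e3) hence `m'_n ≤ m_n` under the conjecture's
own integrality binder (e4) — so ♭ and the landed ♯ SANDWICH never pull a layer in opposite directions; the sketch's three proved lemmas are correct.**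
Semantic anchor (e7, kernel): `P = 4 + 2T` has `twoAdicUnitOrd P = ⊤` but `twoAdicLambdaOrd P = 1` — ♭ carries T-adic information exactly where the
landed rows carry none. Relation to the landed rows (A6): ♭ ∧ ♯(right half) ⇒ `min(s_n,2^n) = m_n` wherever `m'_n = m_n`; ♭ is NOT implied by ♮ ∧ ♯
(on non-degenerate cells ♮-NONDEG already gives `s_n = m_n ≥ m'_n`, but on the 1 537 DEGENERATE cells the landed rows give only the Tamagawa floor
`2^n − Δ_n`, which ♭ beats on 255, ties on 503, loses on 361 — operative bound = max(λ-floor, Tam-floor)). BC7 recheck from `INTERIM2-ROWS.json`: 4 080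
cells, VIOL 0, EQ 3 021, strict 1 059 (n = 1: 915/445; n = 2: 1 001/359; n = 3: 1 105/255), «beyond every other floor» = 460 — -imc's figures line by
line; θ_n, s_n themselves not recomputed (engine-bound; semantics audited §65/§73/§79/§82). Riders f1 (m'_n ≤ m_n «for 2-integral θ»), f2 (integrality
binder = decoration for ♭, load-bearing for ♯/♮), f3 (support theorems e1–e4), f4 (census sentence) — all folded below. REF1 suggested an APPEND to the
shadow module; the typer files a SIBLING module instead because that module is at 395/400 lines (REF1 §82: «either placement is fine for the audit»).
PARTITION: none; beyond-print theorem: no; BSD is NOT proved by any of this.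
REF2-PLACEMENT v20 §2.3 (D-imc-ref2-20 ANSWERED, register d89a76db5ae2bd61; folded text-only by -ty g8): ♭ = **NOT IN PRINT at any p as a statement**
(searched: a generator-wise μ-stripped «Fitt_{Λ_n}(X_n) ⊆ (p^{−μ(θ_n)}θ_n, p^{−μ(θ_{n−1})}νθ_{n−1})» or its 𝔽_p-shadow — KK Thm 1.14/1.18/1.20 state the pair
itself; arXiv 2405.15076 Thm 1.5 is an equality only after ⊗ ℚ_p; arXiv 2511.07203 Thm 1.4 is Fitt⁰-membership of a modified θ^#; Pollack–Weston 2011 compute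
μ/λ of MT elements on the analytic side only); **grade NEW-COMBINATION** — lever 1 = KK Thm 1.18 lower sandwich (this problem), lever 2 = generator-wise μ/λ
separation (Greenberg–Vatsal 2000 / Emerton–Pollack–Weston 2006 / Pollack–Weston 2011), delta = p = 2 with NO Tamagawa/CM/rank hypothesis, justified by
«the defect is scalar» (at odd p where a main conjecture is a theorem, Λ-level equality + control with Tamagawa-bounded SCALAR error — KK Thm 2.6/3.9,
Greenberg LNM 1716 §4, Kim 2022 Rem 4.2 «Tamagawa factors cannot be observed over the cyclotomic tower» — gives Fitt ⊆ pair up to a p-power scalar, exactly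
what generator-wise μ-stripping forgets); beyond-print theorem at 2: YES if proved — it is the Selmer-LOWER-bound (main-conjecture) direction and no MC at
2 is in print (Kriz–Li 2019; KK Rem 1.10); KO 2006 Thm 0.1 (a₂ = ±2 unit corner, μ = 0) is the single printed p = 2 corner, where ♭ holds with equality.
D-imc-ref2-18 (♮) = REF2 v20 §2.1, folded in the shadow module's docstrings.
D-imc-17 FINAL CENSUS (-imc g6 MEMO-imc §10.60 (E), memo e3101983292320d9, 2026-08-28T09:36:58Z; `MEMO-imc-data/dimc17/final/D17-ROWS.json` bced81da731ee1fc,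
`D17-LAMFLOOR.txt` 1ebe10cc90b6934e): P24 λ-FLOOR on all 15 316 decided cells — VIOL 0, EQ 10 438, strict 4 878; OUT OF SAMPLE (11 236 cells) VIOL 0, EQ 7 417, strict
3 819; degenerate cells where the λ-floor beats the Tamagawa floor: IN 255 (186 attained), OOS 1 120 (715 attained); nondegenerate cells by μ-pattern: doubly-unit 2 801
(♭ + ♯ ⇒ exactness by `shadow_exact_of_lambdaFloor_of_sandwich_of_unit`), exactly one μ positive 5 596; VERDICT P24: SURVIVES (pre-registered 08:06Z on the interim sample).
CENSUS / BC5 (-imc g6; kit tag bsd-frontier-data; pre-registered P24 in `MEMO-imc-data/dimc17/README` 2026-08-28T08:07Z BEFORE the 17a, 17b harvest;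
checker `dimc17/lamfloor.py` 21a7cc94cd00a386 → `stream/INTERIM2-LAMFLOOR.txt`): D-imc-17 interim 4 080 cells — VIOLATIONS 0, EQ 3 021, strict 1 059;
beyond EVERY other known lower bound (inheritance s_(n−1), Tamagawa floor m_n − Δ_n) on 460 cells (degenerate Tam-even 167 = 147 EQ + 20 strict;
nondegenerate Tam-even 292; CM 1), e.g. 77a1 n = 2 (m'_2 = 3 = s_2; sandwich floor 2), 129a1 n = 1 (θ_1 = 0 ⇒ m'_1 = 2 = s_1); on degenerate
Tam-even cells it beats the Tamagawa floor on 255 (186 EQ), ties 503, loses 361 — so max(λ-floor, Tam-floor) is the operative bound. KILL RULE (P24):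
one out-of-sample cell with min(s_n, 2^n) < m'_n (verdict MEMO-imc §10.60 with the harvest). WHY NOVEL (-imc 08:07:38Z): the defect of the Kurihara
equality at 2 (it FAILS for 2 ∣ Tam, 77a1 n = 1, §10.59 (C)) is conjectured to be a PURE POWER OF 2 on each generator, never a T-adic factor — a
μ-stripped inclusion «Fitt ⊆ (2^(−μ_n)θ_n, 2^(−μ_(n−1))νθ_(n−1))» whose mod-p shadow is not located in print at any p (REF2 v20 §2.3: confirmed, NEW-COMBINATION).
PARTITION: none moved; beyond-print theorem: no. bears_on: the cell's search question on the SUPERSINGULAR side (finite-layer ± object = the pair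
(θ_n, ν θ_{n−1})); refines IMC-MTF2♯, IMC-MTF2♮; no registered statement item consumes these rows at filing.

Planner's module summary (verbatim, -imc v2.5.1):
# F1Sign2 — IMC lens g6, typing source v2.5 = the IMC-MTF2♭ «LAMBDA-FLOOR» block ONLY (pre-registration P24, MEMO-imc §10.60),
for a further APPEND to the LANDED `F1Sign2/MazurTateFittingShadowAtTwo.lean` (p611562 + p613149; nothing restated, the landed
declarations are imported).

Object: `λ₂(P)` = the index of the first coefficient of MINIMAL `2`-adic valuation of `P ∈ ℚ[X]` (`⊤` iff `P = 0`), i.e. the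
`T`-adic order of `(2^{-μ(P)}·P) mod 2`; it is invariant under `P ↦ c·P` for every `c ∈ ℚˣ` (normalisation-free).
`m'_n := min(2^n, λ₂(θ_n), 2^{n-1} + λ₂(θ_{n-1})) ≤ m_n`.
LAW (IMC-MTF2♭): `min(s_n, 2^n) ≥ m'_n` for every `n ≥ 1` — no Tamagawa, no CM, no rank hypothesis. It is the `𝔽₂`-shadow of
«`Fitt_{Λ_n}(X_n) ⊆ (2^{-μ_n} θ_n, 2^{-μ_{n-1}} ν θ_{n-1})`»: the defect of the Kurihara equality at `p = 2` (which does fail for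
`2 ∣ Tam`, MEMO-imc §10.59 (C): `77a1`, `n = 1`) is a PURE POWER OF `2` on each generator, never a `T`-adic factor.
Interim census (pre-registration P24, 4 080 cells): 0 violations, equality on 3 021 cells, beyond every other known lower bound
(inheritance `s_{n-1}`, Tamagawa floor `m_n − Δ_n`) on 460 cells.
-/

noncomputable section

open scoped Classical
open CongruenceSubgroup Polynomial WeierstrassCurve Literature.NumberTheory.EllipticCurves
  Literature.NumberTheory.EllipticCurves.ModularForms
  Literature.NumberTheory.EllipticCurves.Rank1Residual ZpExtension

open Literature.Barriers.BirchSwinnertonDyer (nRankAtLeast)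

namespace Summit.BirchSwinnertonDyer.Rank1Residual.F1Sign2

/-- `λ₂(P) ∈ ℕ∞`: the least index `i` such that `P.coeff i ≠ 0` has minimal `2`-adic valuation among the non-zero
coefficients of `P` (`⊤` iff `P = 0`). For `2`-integral `P` with a unit coefficient it is `twoAdicUnitOrd P`; in general it is
`twoAdicUnitOrd (2^{-μ₂(P)} • P)`, and `λ₂(c • P) = λ₂(P)` for `c ≠ 0` (the engine's `lam` string). -/
def twoAdicLambdaOrd (P : ℚ[X]) : ℕ∞ :=
  sInf ((fun i : ℕ ↦ (i : ℕ∞)) ''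
    {i : ℕ | P.coeff i ≠ 0 ∧ ∀ j : ℕ, P.coeff j ≠ 0 → padicValRat 2 (P.coeff i) ≤ padicValRat 2 (P.coeff j)})

/-- `m'_n := min(2^n, λ₂(θ_n), 2^{n−1} + λ₂(θ_{n−1}))` — the `T`-adic order of the image in `𝔽₂[T]/(T^{2^n})` of the pair
`(2^{-μ}θ_n, ν_{n−1,n} 2^{-μ}θ_{n−1})` with each generator made `2`-primitive, capped at `2^n`. For `2`-INTEGRAL `θ` one has `m'_n ≤ m_n`
(`mtPairLambdaShadow_le_mtPairShadow` below; REF1 §84 rider f1 — false without integrality: `P = 1 + T/2` has `λ₂ = 1 > 0 = twoAdicUnitOrd`). -/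
def mtPairLambdaShadow (θ : ℕ → ℚ[X]) (n : ℕ) : ℕ∞ :=
  min ((2 ^ n : ℕ) : ℕ∞)
    (min (twoAdicLambdaOrd (θ n)) (((2 ^ (n - 1) : ℕ) : ℕ∞) + twoAdicLambdaOrd (θ (n - 1))))

/-- The `μ`-stripped shadow never exceeds the cap `2^n` (it is a `min` with it). -/
theorem mtPairLambdaShadow_le (θ : ℕ → ℚ[X]) (n : ℕ) :
    mtPairLambdaShadow θ n ≤ ((2 ^ n : ℕ) : ℕ∞) := min_le_left _ _

/-- On a `2`-integral polynomial with a unit coefficient (`μ₂(P) = 0`) the `μ`-stripped order is the plain shadow order: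
`λ₂(P) = twoAdicUnitOrd P`. Hence `m'_n = m_n` on every layer with `μ(θ_n) = μ(θ_{n−1}) = 0`. -/
theorem twoAdicLambdaOrd_eq_twoAdicUnitOrd (P : ℚ[X]) (hint : ∀ i : ℕ, 0 ≤ padicValRat 2 (P.coeff i))
    (hunit : ∃ i : ℕ, P.coeff i ≠ 0 ∧ padicValRat 2 (P.coeff i) = 0) :
    twoAdicLambdaOrd P = twoAdicUnitOrd P := by
  obtain ⟨i₀, hi₀, hv₀⟩ := hunit
  have hset : {i : ℕ | P.coeff i ≠ 0 ∧ ∀ j : ℕ, P.coeff j ≠ 0 → padicValRat 2 (P.coeff i) ≤ padicValRat 2 (P.coeff j)}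
      = {i : ℕ | P.coeff i ≠ 0 ∧ padicValRat 2 (P.coeff i) = 0} := by
    ext i
    simp only [Set.mem_setOf_eq]
    constructor
    · rintro ⟨hi, hmin⟩
      exact ⟨hi, le_antisymm (hv₀ ▸ hmin i₀ hi₀) (hint i)⟩
    · rintro ⟨hi, hv⟩
      exact ⟨hi, fun j _ ↦ hv ▸ hint j⟩
  unfold twoAdicLambdaOrd twoAdicUnitOrd
  rw [hset]

/-- `μ(θ_n) = μ(θ_{n−1}) = 0` (both `2`-integral with a unit coefficient) ⇒ `m'_n = m_n`. -/
theorem mtPairLambdaShadow_eq_mtPairShadow (θ : ℕ → ℚ[X]) (n : ℕ)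
    (hint : ∀ m i : ℕ, 0 ≤ padicValRat 2 ((θ m).coeff i))
    (hn : ∃ i : ℕ, (θ n).coeff i ≠ 0 ∧ padicValRat 2 ((θ n).coeff i) = 0)
    (hn' : ∃ i : ℕ, (θ (n - 1)).coeff i ≠ 0 ∧ padicValRat 2 ((θ (n - 1)).coeff i) = 0) :
    mtPairLambdaShadow θ n = mtPairShadow θ n := by
  unfold mtPairLambdaShadow mtPairShadow
  rw [twoAdicLambdaOrd_eq_twoAdicUnitOrd _ (hint n) hn, twoAdicLambdaOrd_eq_twoAdicUnitOrd _ (hint (n - 1)) hn']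

/-- **IMC-MTF2♭ (LAMBDA-FLOOR) `MazurTateLambdaFloorAtTwo`** — candidate, conjecture-grade, pre-registered (README P24) before
the out-of-sample harvest. For `W/ℚ` globally minimal, good supersingular at `2`, newform `f`, period pin, `θ_n := ϖ·θ_n(f)`
(`2`-integrality kept only for uniformity with the sibling rows — `m'_n` is invariant under rescaling each `θ_n` by a non-zero
rational; REF1 §84 rider f2: the binder is DECORATION for ♭ (`twoAdicLambdaOrd_C_mul`), load-bearing for ♯ and ♮; `ϖ` is fixed by the pin, so it
only decides which curves are in scope — all 5 109 census curves are): for every `n ≥ 1` and `k ≤ 2^n`, `k ≤ m'_n ⇒ rk₂ Sel_{2^∞}(W/ℚ_n) ≥ k`,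
i.e. `min(s_n, 2^n) ≥ m'_n`.
No Tamagawa, CM or rank hypothesis. With `MazurTateFittingSandwichAtTwo` (right half) it gives `min(s_n,2^n) = m_n` on every layer
with `m'_n = m_n` (`shadow_exact_of_lambdaFloor_of_sandwich`). KILL RULE: one cell with `min(s_n, 2^n) < m'_n`.
Interim census: 4 080/4 080 cells (EQ 3 021, strict 1 059; beyond inheritance-and-Tamagawa floors on 460 cells, e.g. `77a1` `n = 2`:
`m'_2 = 3 = s_2`, `129a1` `n = 1`: `θ_1 = 0`, `m'_1 = 2 = s_1`). REF1 §84 rider f4: on NON-degenerate cells (`m_n < 2^n`) this statement is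
implied by IMC-MTF2♮ NONDEG (`s_n = m_n ≥ m'_n`: 2 346 cells floor = shadow, 197 floor < shadow); its INDEPENDENT content is on the 1 537 DEGENERATE
cells, where it beats the Tamagawa floor `2^n − Δ_n` of the landed SANDWICH on 255 (186 attained, 69 strict), ties on 503 and is weaker on 361.
REF1-AUDIT §84 (2026-08-28T08:26:10Z): SURVIVES conjecture-grade (pre-registered; interim 4 080 cells, 0 violations reproduced independently), CLEARED for
filing as typed. REF2 v20 §2.3: NOT IN PRINT at any `p` as a statement; NEW-COMBINATION (Kim–Kurihara Thm. 1.18's lower sandwich ×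
generator-wise `μ/λ` separation); rider f1: this is the `𝔽₂`-shadow of the `μ`-stripped Skinner–Urban-direction inclusion — at odd `p` a
consequence of IMC + control up to `p`-power scalars (Kim–Kurihara Thm. 2.6/3.9), at `p = 2` open; rider f2: Kim–Kurihara Thm. 1.14's Tamagawa-free
part is the OTHER inclusion `(θ_n, νθ_{n−1}) ⊆ Fitt` and is not a source for this direction (Conj. 1.6 and Rem. 1.10 are cited for the conjecture and
its `p = 2` caveat; Kurihara–Otsuki Thm. 0.1 is the printed `p = 2` corner, equality). [cite: KimKurihara2021, Conj. 1.6, Thm. 1.18, Thm. 2.6, Rem. 1.10]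
[cite: KuriharaOtsuki2006, Thm. 0.1] [cite: Kim2022StructureSelmer, Rem. 4.2] -/
@[conjecture] def MazurTateLambdaFloorAtTwo : Prop :=
  ∀ {N : ℕ} [NeZero N] (f : CuspForm (Gamma0 N) 2) (W : WeierstrassCurve ℚ) [W.IsElliptic] [W.IsGloballyMinimal]
    (ϖ : ℚ), IsNewformOf W f → GoodSS W 2 →
    (ϖ : ℝ) * W.realPeriodRat = plusPeriod f →
    (∀ n i : ℕ, 0 ≤ padicValRat 2 ((C ϖ * mazurTateElement f 2 n).coeff i)) →
    ∀ (κ : ZpExtension ℚ 2), κ.IsCyclotomic →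
    ∀ n k : ℕ, 1 ≤ n → k ≤ 2 ^ n →
      (k : ℕ∞) ≤ mtPairLambdaShadow (fun m ↦ C ϖ * mazurTateElement f 2 m) n →
        nRankAtLeast (↥(W.selmerLayer κ n)) 2 k

/-- LAMBDA-FLOOR + the right half of the SANDWICH (= WEAK without the CM binder) ⇒ EXACTNESS `min(s_n,2^n) = m_n` on every layer
where the `μ`-stripped shadow equals the shadow (`m'_n = m_n`, e.g. whenever `μ(θ_n) = μ(θ_{n−1}) = 0`). -/
theorem shadow_exact_of_lambdaFloor_of_sandwich (h₁ : MazurTateLambdaFloorAtTwo) (h₂ : MazurTateFittingSandwichAtTwo)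
    {N : ℕ} [NeZero N] (f : CuspForm (Gamma0 N) 2) (W : WeierstrassCurve ℚ) [W.IsElliptic] [W.IsGloballyMinimal]
    (ϖ : ℚ) (hf : IsNewformOf W f) (hss : GoodSS W 2)
    (hpin : (ϖ : ℝ) * W.realPeriodRat = plusPeriod f)
    (hint : ∀ n i : ℕ, 0 ≤ padicValRat 2 ((C ϖ * mazurTateElement f 2 n).coeff i))
    (κ : ZpExtension ℚ 2) (hκ : κ.IsCyclotomic) (n k : ℕ) (hn : 1 ≤ n) (hk : k ≤ 2 ^ n)
    (heq : mtPairLambdaShadow (fun m ↦ C ϖ * mazurTateElement f 2 m) n =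
      mtPairShadow (fun m ↦ C ϖ * mazurTateElement f 2 m) n) :
    nRankAtLeast (↥(W.selmerLayer κ n)) 2 k ↔
      (k : ℕ∞) ≤ mtPairShadow (fun m ↦ C ϖ * mazurTateElement f 2 m) n := by
  refine ⟨fun hsel ↦ (h₂ f W ϖ hf hss hpin hint κ hκ n k hn hk).2 hsel, fun hle ↦ ?_⟩
  exact h₁ f W ϖ hf hss hpin hint κ hκ n k hn hk (heq ▸ hle)

/-- LAMBDA-FLOOR + SANDWICH ⇒ `min(s_n, 2^n) = m_n` on every layer where `θ_n` and `θ_{n−1}` both have a `2`-adic unit coefficient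
(`μ = 0` twice) — no Tamagawa, CM or rank hypothesis (this is the part of IMC-MTF2♮ NONDEG that ♭ + ♯ already deliver). -/
theorem shadow_exact_of_lambdaFloor_of_sandwich_of_unit (h₁ : MazurTateLambdaFloorAtTwo)
    (h₂ : MazurTateFittingSandwichAtTwo)
    {N : ℕ} [NeZero N] (f : CuspForm (Gamma0 N) 2) (W : WeierstrassCurve ℚ) [W.IsElliptic] [W.IsGloballyMinimal]
    (ϖ : ℚ) (hf : IsNewformOf W f) (hss : GoodSS W 2)
    (hpin : (ϖ : ℝ) * W.realPeriodRat = plusPeriod f)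
    (hint : ∀ n i : ℕ, 0 ≤ padicValRat 2 ((C ϖ * mazurTateElement f 2 n).coeff i))
    (κ : ZpExtension ℚ 2) (hκ : κ.IsCyclotomic) (n k : ℕ) (hn : 1 ≤ n) (hk : k ≤ 2 ^ n)
    (hu : ∃ i : ℕ, (C ϖ * mazurTateElement f 2 n).coeff i ≠ 0 ∧
      padicValRat 2 ((C ϖ * mazurTateElement f 2 n).coeff i) = 0)
    (hu' : ∃ i : ℕ, (C ϖ * mazurTateElement f 2 (n - 1)).coeff i ≠ 0 ∧
      padicValRat 2 ((C ϖ * mazurTateElement f 2 (n - 1)).coeff i) = 0) :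
    nRankAtLeast (↥(W.selmerLayer κ n)) 2 k ↔
      (k : ℕ∞) ≤ mtPairShadow (fun m ↦ C ϖ * mazurTateElement f 2 m) n :=
  shadow_exact_of_lambdaFloor_of_sandwich h₁ h₂ f W ϖ hf hss hpin hint κ hκ n k hn hk
    (mtPairLambdaShadow_eq_mtPairShadow (fun m ↦ C ϖ * mazurTateElement f 2 m) n hint hu hu')

/-! ## Support (PROVED; REF1-AUDIT §84 rider f3): the structural claims of the two docstrings as kernel facts

Bodies verbatim from REF1's kernel-clean probe `HOME/REF1-data/b84/Probe84.lean` 39460b7946f7b6c9 (audit lemmas e1–e4; farm rc 0, axioms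
{propext, Classical.choice, Quot.sound}), renamed `e1_lambdaOrd_zero` ↦ `twoAdicLambdaOrd_zero`, `e2_lambdaOrd_C_mul` ↦ `twoAdicLambdaOrd_C_mul`,
`e3_lambdaOrd_le_unitOrd` ↦ `twoAdicLambdaOrd_le_twoAdicUnitOrd`, `e4_lambdaShadow_le_shadow` ↦ `mtPairLambdaShadow_le_mtPairShadow` (REF1's suggested
names); docstrings added by the typer. Theorems about the carriers of this file and the landed shadow file only. -/

/-- `λ₂(0) = ⊤` (REF1 §84 e1; the engine's INF sentinel `mu = 99`: on a `θ_n = 0` layer the floor is `min(2^n, 2^(n−1) + λ₂(θ_(n−1)))`). -/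
theorem twoAdicLambdaOrd_zero : twoAdicLambdaOrd 0 = ⊤ := by
  simp [twoAdicLambdaOrd]

/-- **NORMALISATION-FREENESS (REF1 §84 e2).** `λ₂(c·P) = λ₂(P)` for `c ≠ 0` — the defining set of indices is literally the same set; so
`m'_n` does not see the period normalisation `ϖ`, and the integrality binder of `MazurTateLambdaFloorAtTwo` is decoration (rider f2). -/
theorem twoAdicLambdaOrd_C_mul (c : ℚ) (hc : c ≠ 0) (P : ℚ[X]) :
    twoAdicLambdaOrd (C c * P) = twoAdicLambdaOrd P := by
  have hset : {i : ℕ | (C c * P).coeff i ≠ 0 ∧ ∀ j : ℕ, (C c * P).coeff j ≠ 0 →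
        padicValRat 2 ((C c * P).coeff i) ≤ padicValRat 2 ((C c * P).coeff j)}
      = {i : ℕ | P.coeff i ≠ 0 ∧ ∀ j : ℕ, P.coeff j ≠ 0 → padicValRat 2 (P.coeff i) ≤ padicValRat 2 (P.coeff j)} := by
    ext i
    simp only [Set.mem_setOf_eq, coeff_C_mul]
    constructor
    · rintro ⟨hi, hmin⟩
      have hi' : P.coeff i ≠ 0 := fun h ↦ hi (by rw [h, mul_zero])
      refine ⟨hi', fun j hj ↦ ?_⟩
      have h := hmin j (mul_ne_zero hc hj)
      rw [padicValRat.mul hc hi', padicValRat.mul hc hj] at h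
      linarith
    · rintro ⟨hi, hmin⟩
      refine ⟨mul_ne_zero hc hi, fun j hj ↦ ?_⟩
      have hj' : P.coeff j ≠ 0 := fun h ↦ hj (by rw [h, mul_zero])
      rw [padicValRat.mul hc hi, padicValRat.mul hc hj']
      have h := hmin j hj'
      linarith
  unfold twoAdicLambdaOrd
  rw [hset]

/-- **FLOOR ≤ CAP INGREDIENT (REF1 §84 e3).** For `2`-integral `P`: `λ₂(P) ≤ twoAdicUnitOrd P` (equality iff a unit coefficient exists —
`twoAdicLambdaOrd_eq_twoAdicUnitOrd` — else the right side is `⊤`). -/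
theorem twoAdicLambdaOrd_le_twoAdicUnitOrd (P : ℚ[X]) (hint : ∀ i : ℕ, 0 ≤ padicValRat 2 (P.coeff i)) :
    twoAdicLambdaOrd P ≤ twoAdicUnitOrd P := by
  by_cases hu : ∃ i : ℕ, P.coeff i ≠ 0 ∧ padicValRat 2 (P.coeff i) = 0
  · exact (twoAdicLambdaOrd_eq_twoAdicUnitOrd P hint hu).le
  · have hset : {i : ℕ | P.coeff i ≠ 0 ∧ padicValRat 2 (P.coeff i) = 0} = ∅ := by
      ext i
      simp only [Set.mem_setOf_eq, Set.mem_empty_iff_false, iff_false]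
      exact fun h ↦ hu ⟨i, h⟩
    unfold twoAdicUnitOrd
    rw [hset]
    simp

/-- **`m'_n ≤ m_n` for `2`-integral families (REF1 §84 e4, rider f1).** Under the conjecture's own `hint` binder the LAMBDA-FLOOR never exceeds
the landed SANDWICH's cap: ♭ and ♯ are jointly consistent (no layer where ♭ would demand rank above ♯'s upper bound). -/
theorem mtPairLambdaShadow_le_mtPairShadow (θ : ℕ → ℚ[X]) (n : ℕ) (hint : ∀ m i : ℕ, 0 ≤ padicValRat 2 ((θ m).coeff i)) :
    mtPairLambdaShadow θ n ≤ mtPairShadow θ n := by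
  unfold mtPairLambdaShadow mtPairShadow
  gcongr
  · exact twoAdicLambdaOrd_le_twoAdicUnitOrd _ (hint n)
  · exact twoAdicLambdaOrd_le_twoAdicUnitOrd _ (hint (n - 1))

end Summit.BirchSwinnertonDyer.Rank1Residual.F1Sign2

end
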